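/-
Copyright (c) 2026 The HCML crux team. All rights reserved.
Released under Apache 2.0 license as described in the file LICENSE.
Authors: K2E3-p23 (g5) (explicit-unit `hodgecm-mathlib-K2E3-p23-g5`)
-/
import Summits.HodgeConjecture.HodgeConjecture.Theorems.K2E3GL3ModCocompactCharLocInt            -- ★ (B6-core) p857845 (this seat)
import Summits.HodgeConjecture.HodgeConjecture.Theorems.K2E3GL3ModCocompactFrame                  -- ★ (B2) p857849 (K2E3-p03 (g4))
import Summits.HodgeConjecture.HodgeConjecture.Theorems.K2E3GL3ModUniformizerCocompact            -- ★ (B0z) p857882 (this seat)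
import Summits.HodgeConjecture.HodgeConjecture.Theorems.K2E3GL3SupercuspidalTwistDescentTwist     -- ★ (B0c) p857846 + p857873 (K2E3-p21 (g4))
import Summits.HodgeConjecture.HodgeConjecture.Theorems.K2E3SmoothTraceTwist                      -- ★ (B0c (d)) p857902 (this seat)
import Summits.HodgeConjecture.HodgeConjecture.Theorems.K2E3CharLocIntNearCoveringTransport       -- ★ (B0b) (K2E5-p17 (g4))
import Literature.NumberTheory.Automorphic.MatrixCoefficientsTrivialRep                           -- ★ `Representation.mem_contragredient_twist`
import Literature.NumberTheory.Automorphic.HeckeTransversalGL                                     -- ★ `valuation_det_eq_one_of_mem_glInt`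
import HarnessLib

/-!
# (GL-[M6]-sc, B6-final) Harish-Chandra's local integrability for SUPERCUSPIDAL `GL₃(F)`, modulo the non-elliptic estimates on `GL₃(F) ⧸ ϖ^ℤ`

Cell `hodgecm-mathlib`, Track B, line `K2_E3_EllipticInputs`; payer «GL-[M6]-sc» of leaf (11-3-split-sc) `sig_K2E3CharLocIntNearSemisimpleSplitThreeSupercuspidal`
(dealer K2E3-plan (g3) D63, line lead K2E3-p23 (g5); MEMO «M6sc-ROAD v2», RULINGS #5 (M5-2) «Λ₀ := zpowers ϖ»).  THE ASSEMBLY on `GL₃(F)`: for `F` a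
non-archimedean local field of characteristic `0` with uniformizer `ϖ`, IF the NON-ELLIPTIC ESTIMATES hold on `G' := GL₃(F) ⧸ ϖ^ℤ·1` (hypothesis `hNE`: for every
Haar measure, every supercuspidal `r` of `G'`, every `r`-invariant sesquilinear `B` and every vector `v₁`, a compact exhaustion `Ω` along which the truncated orbital
integrals of the coefficient `y ↦ B v₁ (r y v₁)` CONVERGE and are DOMINATED by an `L¹_loc` function almost everywhere OFF the compact-centraliser set — Harish-Chandra
1970 Thms 18–20 + 15, bricks B4/B5 of the road), THEN for every Haar `μ₀` on `GL₃(F)`, every admissible supercuspidal irreducible `r₀` and EVERY `g ∈ GL₃(F)` the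
character of `[r₀]` is an integrable function near `g` («charLocIntNear g»).  Chain (all ★): unramified twist `r₁ = r₀ ⊗ χ∘det` trivial on `ϖ·1` (★ B0c) ↦ descent
`r♭` to `G'` (★ B0c) ↦ frame of `G'` (★ B2: nonarchimedean, compact centre, inversion-invariant Haar; ★ B0z: `ϖ^ℤ` closed cocompact) ↦ ★ B6-core (HC Thm 16 at `G'`
modulo `hNE`, elliptic half ★ B3) ↦ «charLocIntNear (mk g) for r♭» ↦ ★ B0b (covering transport along `mk`, kernel `ϖ^ℤ·1` discrete: `GL₃(𝒪) ∩ ϖ^ℤ·1 = 1`) ↦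
«charLocIntNear g for r₁ = r♭ ∘ mk» ↦ ★ B0c (d) (untwist) ↦ «charLocIntNear g for r₀».

* §1 `isSupercuspidal_twist` (twisting by a smooth character preserves supercuspidality), `eq_one_of_mem_glInt_of_mk_eq_one` (the kernel `ϖ^ℤ·1` meets `GL₃(𝒪)`
  trivially).
* §2 **`charLocIntNear_gl3_supercuspidal_of_nonell`**.

HONEST LABEL: HC_CM is proved only modulo the 7 printed citations (2 remaining named inputs: hLiu418 = stmt-HodgeConjecture-24832, h413 =
stmt-HodgeConjecture-24833) until rung 0 closes; count-neutral (kernel lane `--supports stmt-HodgeConjecture-24833 --as helper`); CONDITIONAL on `hNE` (bricks B4/B5,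
OPEN — the XL core of the road); with ★ B6-T it yields the leaf (11-3-split-sc) modulo `hNE` only.

References: Harish-Chandra (van Dijk) 1970, Part VII Thm 16 p. 67, Thms 18–20 pp. 69–70, §3 pp. 70–73 [cite: HarishChandra1970, Part VII Thm 16 p. 67];
Rogawski 1990 §12.2 p. 173 [cite: Rogawski1990, §12.2 p. 173]; Bushnell–Henniart 2006 §9.1 (twists) [cite: BushnellHenniart2006, §9.1].
-/

open MeasureTheory MeasureTheory.Measure Set Function Filter
open scoped NNReal ENNReal MatrixGroups Pointwise WithZero Valued Topology
open Matrix ValuativeRel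
open Literature.NumberTheory.Automorphic Literature.NumberTheory.GaloisRepresentations Literature.NumberTheory.GaloisRepresentations.IsNonarchimedeanLocalField
open Summit.HodgeConjecture.HodgeConjecture.Cruxes.H413.K2E3GL3ModCentre Summit.HodgeConjecture.HodgeConjecture.Cruxes.H413.K2E3GL3ModCocompactCentral
open Summit.HodgeConjecture.HodgeConjecture.Cruxes.H413.K2E3GL3ModCocompactUnimodular Summit.HodgeConjecture.HodgeConjecture.Cruxes.H413.K2E3GL3ModCocompactFrame
open Summit.HodgeConjecture.HodgeConjecture.Cruxes.H413.K2E3GL3ModUniformizerCocompact Summit.HodgeConjecture.HodgeConjecture.Cruxes.H413.K2E3GL3ModCocompactCharLocInt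
open Summit.HodgeConjecture.HodgeConjecture.Cruxes.H413.K2E3GL3SupercuspidalTwistDescent Summit.HodgeConjecture.HodgeConjecture.Cruxes.H413.K2E3GL3SupercuspidalTwistDescentTwist

set_option linter.dupNamespace false

noncomputable section

namespace Summit.HodgeConjecture.HodgeConjecture.Cruxes.H413.K2E3GL3SupercuspidalCharLocInt

/-! ## §1 Two small facts -/

section Aux

/-- **Twisting by a smooth character preserves supercuspidality** (coefficients compactly supported modulo the centre): the smooth duals agree
(★ `mem_contragredient_twist` through `ξ⁻¹`, `(ρ ⊗ ξ) ⊗ ξ⁻¹ = ρ`) and `c^{ρ⊗ξ}_{φ,v} = ξ · c^{ρ}_{φ,v}` (★ `matrixCoeff_twist`) has the same support.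
[cite: BushnellHenniart2006, §9.1] [cite: HarishChandra1970, Part I §3 p. 9] -/
theorem isSupercuspidal_twist {G V : Type*} [Group G] [TopologicalSpace G] [IsTopologicalGroup G] [AddCommGroup V] [Module ℂ V]
    {ρ : Representation ℂ G V} (hsc : ρ.IsSupercuspidal) {ξ : G →* ℂˣ} (hξ : IsOpen (ξ.ker : Set G)) : (ρ.twist ξ).IsSupercuspidal := by
  intro φ hφ v
  have hξinv : IsOpen ((ξ⁻¹).ker : Set G) := by rw [K2E3SmoothTraceTwist.ker_inv_eq]; exact hξ
  have hξξ : ξ * ξ⁻¹ = 1 := MonoidHom.ext fun g => by rw [MonoidHom.mul_apply, MonoidHom.inv_apply, mul_inv_cancel, MonoidHom.one_apply]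
  have hφ' : φ ∈ ρ.contragredient := by
    have h := Representation.mem_contragredient_twist (ρ.twist ξ) hξinv hφ
    rwa [Representation.twist_twist, hξξ, Representation.twist_one] at h
  obtain ⟨C, hC, hsupp⟩ := hsc φ hφ' v
  refine ⟨C, hC, fun g hg => hsupp ?_⟩
  rw [Function.mem_support] at hg ⊢
  rw [Representation.matrixCoeff_twist] at hg
  exact right_ne_zero_of_mul hg

variable {F : Type*} [Field F] [Valued F ℤᵐ⁰] [ValuativeRel F] [(Valued.v : Valuation F ℤᵐ⁰).Compatible] [IsNonarchimedeanLocalField F]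

omit [IsNonarchimedeanLocalField F] in
/-- **`GL₃(𝒪) ∩ ϖ^ℤ·1 = 1`**: an element of `GL₃(𝒪)` that dies in `GL₃(F) ⧸ ϖ^ℤ·1` is `1` (`det (ϖ^k·1) = ϖ^{3k}` is a unit only for `k = 0`) — the discreteness input
`hker` of ★ B0b. [cite: PlatonovRapinchuk1994, §3.3] -/
theorem eq_one_of_mem_glInt_of_mk_eq_one {ϖ : F} (hϖ : Valued.v ϖ = WithZero.exp (-1 : ℤ)) (hϖ0 : ϖ ≠ 0)
    [((Subgroup.zpowers (Units.mk0 ϖ hϖ0)).map (Matrix.GeneralLinearGroup.scalar (Fin 3))).Normal]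
    {x : GL (Fin 3) F} (hx : x ∈ glInt 3 F)
    (h1 : (QuotientGroup.mk x : GL (Fin 3) F ⧸ (Subgroup.zpowers (Units.mk0 ϖ hϖ0)).map (Matrix.GeneralLinearGroup.scalar (Fin 3))) = 1) : x = 1 := by
  rw [QuotientGroup.eq_one_iff] at h1
  obtain ⟨u, hu, rfl⟩ := Subgroup.mem_map.1 h1
  obtain ⟨k, rfl⟩ := Subgroup.mem_zpowers_iff.1 hu
  have hdet := valuation_det_eq_one_of_mem_glInt hx
  rw [← v_eq_one_iff_valuation_eq_one, ← Matrix.GeneralLinearGroup.val_det_apply, det_scalar_eq_pow, ← zpow_natCast, ← _root_.zpow_mul,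
    v_units_zpow_uniformizer hϖ hϖ0, WithZero.exp_eq_one, neg_eq_zero] at hdet
  have hk : k = 0 := by
    have h3 : k * ((3 : ℕ) : ℤ) = 0 := hdet
    simpa using h3
  subst hk
  rw [zpow_zero, map_one]

end Aux

/-! ## §2 The assembly on `GL₃(F)` -/

section Main

variable {F : Type*} [Field F] [Valued F ℤᵐ⁰] [ValuativeRel F] [(Valued.v : Valuation F ℤᵐ⁰).Compatible] [IsNonarchimedeanLocalField F] [CharZero F]

/-- **(GL-[M6]-sc, B6-final) LOCAL INTEGRABILITY OF SUPERCUSPIDAL CHARACTERS OF `GL₃(F)` NEAR EVERY POINT, MODULO THE NON-ELLIPTIC ESTIMATES ON `GL₃(F) ⧸ ϖ^ℤ`.**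
`hNE` = for every Haar measure `μ` on `G' = GL₃(F) ⧸ ϖ^ℤ·1`, every supercuspidal `r : SmoothIrrep G'`, every `r`-invariant sesquilinear `B` and every `v₁`: a compact
exhaustion `Ω` of `G'` and `Fl`, `M` with (lim∖ell) `Θₙ(g) := ∫_{Ω n} B v₁ (r(xgx⁻¹) v₁) dμ → Fl g` and (dom∖ell) `‖Θₙ g‖ ≤ M g` for a.e. `g` with NON-compact
centraliser, all `n`, `M ∈ L¹_loc(μ)` (Harish-Chandra 1970, Thms 18–20, 15 — bricks B4/B5).  CONCLUSION: for every Haar `μ₀` on `GL₃(F)`, every admissible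
supercuspidal irreducible `r₀`, every `g`: an open `U ∋ g`, `Θ ∈ L¹(U, μ₀)`, `χ_{[r₀]}(f) = ∫ f Θ dμ₀` for all test functions supported in `U`.  Proof = the ★ chain
B0c (twist, descend) → B2∕B0z (frame) → B6-core → B0b (covering transport) → B0c (d) (untwist).
[cite: HarishChandra1970, Part VII Thm 16 p. 67] [cite: Rogawski1990, §12.2 p. 173] [cite: BushnellHenniart2006, §9.1] -/
theorem charLocIntNear_gl3_supercuspidal_of_nonell {ϖ : F} (hϖ : Valued.v ϖ = WithZero.exp (-1 : ℤ)) (hϖ0 : ϖ ≠ 0)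
    [((Subgroup.zpowers (Units.mk0 ϖ hϖ0)).map (Matrix.GeneralLinearGroup.scalar (Fin 3))).Normal]
    (hNE : ∀ [MeasurableSpace (GL (Fin 3) F ⧸ (Subgroup.zpowers (Units.mk0 ϖ hϖ0)).map (Matrix.GeneralLinearGroup.scalar (Fin 3)))]
      [BorelSpace (GL (Fin 3) F ⧸ (Subgroup.zpowers (Units.mk0 ϖ hϖ0)).map (Matrix.GeneralLinearGroup.scalar (Fin 3)))]
      (μ : Measure (GL (Fin 3) F ⧸ (Subgroup.zpowers (Units.mk0 ϖ hϖ0)).map (Matrix.GeneralLinearGroup.scalar (Fin 3)))) [μ.IsHaarMeasure]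
      (r : SmoothIrrep (GL (Fin 3) F ⧸ (Subgroup.zpowers (Units.mk0 ϖ hϖ0)).map (Matrix.GeneralLinearGroup.scalar (Fin 3)))), r.ρ.IsSupercuspidal →
      ∀ (B : r.V →ₗ⋆[ℂ] r.V →ₗ[ℂ] ℂ),
        (∀ (g : GL (Fin 3) F ⧸ (Subgroup.zpowers (Units.mk0 ϖ hϖ0)).map (Matrix.GeneralLinearGroup.scalar (Fin 3))) (x y : r.V), B (r.ρ g x) (r.ρ g y) = B x y) →
      ∀ (v₁ : r.V),
        ∃ (Ω : CompactExhaustion (GL (Fin 3) F ⧸ (Subgroup.zpowers (Units.mk0 ϖ hϖ0)).map (Matrix.GeneralLinearGroup.scalar (Fin 3))))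
          (Fl : (GL (Fin 3) F ⧸ (Subgroup.zpowers (Units.mk0 ϖ hϖ0)).map (Matrix.GeneralLinearGroup.scalar (Fin 3))) → ℂ)
          (M : (GL (Fin 3) F ⧸ (Subgroup.zpowers (Units.mk0 ϖ hϖ0)).map (Matrix.GeneralLinearGroup.scalar (Fin 3))) → ℝ),
          (∀ᵐ g ∂μ, ¬ IsCompact ((Subgroup.centralizer ({g} : Set (GL (Fin 3) F ⧸ (Subgroup.zpowers (Units.mk0 ϖ hϖ0)).map (Matrix.GeneralLinearGroup.scalar (Fin 3))))) :
              Set (GL (Fin 3) F ⧸ (Subgroup.zpowers (Units.mk0 ϖ hϖ0)).map (Matrix.GeneralLinearGroup.scalar (Fin 3)))) →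
            Tendsto (fun n => ∫ x in Ω n, B v₁ (r.ρ (x * g * x⁻¹) v₁) ∂μ) atTop (𝓝 (Fl g))) ∧
          (∀ n, ∀ᵐ g ∂μ, ¬ IsCompact ((Subgroup.centralizer ({g} : Set (GL (Fin 3) F ⧸ (Subgroup.zpowers (Units.mk0 ϖ hϖ0)).map (Matrix.GeneralLinearGroup.scalar (Fin 3))))) :
              Set (GL (Fin 3) F ⧸ (Subgroup.zpowers (Units.mk0 ϖ hϖ0)).map (Matrix.GeneralLinearGroup.scalar (Fin 3)))) →
            ‖∫ x in Ω n, B v₁ (r.ρ (x * g * x⁻¹) v₁) ∂μ‖ ≤ M g) ∧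
          LocallyIntegrable M μ)
    [MeasurableSpace (GL (Fin 3) F)] [BorelSpace (GL (Fin 3) F)] (μ₀ : Measure (GL (Fin 3) F)) [μ₀.IsHaarMeasure]
    (r₀ : SmoothIrrep (GL (Fin 3) F)) (hadm : r₀.ρ.IsAdmissible) (hsc : r₀.ρ.IsSupercuspidal) (g : GL (Fin 3) F) :
    ∃ U : Set (GL (Fin 3) F), IsOpen U ∧ g ∈ U ∧ ∃ Θ : GL (Fin 3) F → ℂ, IntegrableOn Θ U μ₀ ∧
      ∀ f : GL (Fin 3) F → ℂ, f ∈ SchwartzBruhat (GL (Fin 3) F) → tsupport f ⊆ U → (IrrClass.mk r₀).smoothTrace μ₀ f = ∫ x, f x * Θ x ∂μ₀ := by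
  -- §0 frame on `GL₃(F)`
  haveI : IsTopologicalRing F := inferInstance
  haveI : T2Space F := (isLocalField F).toT2Space
  haveI : SecondCountableTopology (GL (Fin 3) F) := secondCountableTopology_gl3 F
  haveI : LocallyCompactSpace (GL (Fin 3) F) := locallyCompactSpace_gl3 F
  haveI : NonarchimedeanGroup (GL (Fin 3) F) := nonarchimedeanGroup_gl F 3
  -- §1 the unramified twist `r₁ = r₀ ⊗ χ∘det`, trivial on `ϖ·1` (★ B0c)
  obtain ⟨χ, hχdet, -, -, hr₁⟩ := exists_unramified_twist_apply_scalar_eq_one hϖ hϖ0 r₀ hadm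
  have hadm₁ : (r₀.twist (χ.comp Matrix.GeneralLinearGroup.det) hχdet).ρ.IsAdmissible := hadm.twist hχdet
  have hsc₁ : (r₀.twist (χ.comp Matrix.GeneralLinearGroup.det) hχdet).ρ.IsSupercuspidal := isSupercuspidal_twist hsc hχdet
  -- §2 the descent `r♭` to `G'` (★ B0c)
  obtain ⟨r', e, he, hsc', hadm'⟩ := exists_smoothIrrep_quotScalar hϖ0 (r₀.twist (χ.comp Matrix.GeneralLinearGroup.det) hχdet) hr₁
  have hsc'' := hsc' hsc₁
  have hadm'' := hadm' hadm₁
  -- §3 the frame of `G'` (★ B2, ★ B0z)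
  letI : MeasurableSpace (GL (Fin 3) F ⧸ (Subgroup.zpowers (Units.mk0 ϖ hϖ0)).map (Matrix.GeneralLinearGroup.scalar (Fin 3))) := borel _
  haveI : BorelSpace (GL (Fin 3) F ⧸ (Subgroup.zpowers (Units.mk0 ϖ hϖ0)).map (Matrix.GeneralLinearGroup.scalar (Fin 3))) := ⟨rfl⟩
  haveI : NonarchimedeanGroup (GL (Fin 3) F ⧸ (Subgroup.zpowers (Units.mk0 ϖ hϖ0)).map (Matrix.GeneralLinearGroup.scalar (Fin 3))) :=
    nonarchimedeanGroup_quotScalar _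
  haveI : CompactSpace (Fˣ ⧸ Subgroup.zpowers (Units.mk0 ϖ hϖ0)) := compactSpace_units_quot_zpowers_uniformizer hϖ hϖ0
  have hΛ : IsClosed ((Subgroup.zpowers (Units.mk0 ϖ hϖ0) : Subgroup Fˣ) : Set Fˣ) := isClosed_zpowers_uniformizer hϖ hϖ0
  haveI : T2Space (GL (Fin 3) F ⧸ (Subgroup.zpowers (Units.mk0 ϖ hϖ0)).map (Matrix.GeneralLinearGroup.scalar (Fin 3))) := t2Space_quotScalar _ hΛ
  set μ' : Measure (GL (Fin 3) F ⧸ (Subgroup.zpowers (Units.mk0 ϖ hϖ0)).map (Matrix.GeneralLinearGroup.scalar (Fin 3))) := Measure.haar with hμ'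
  haveI : μ'.IsInvInvariant := isInvInvariant_quotScalar_of_isHaarMeasure _ hΛ hϖ μ'
  have hZ := isCompact_center_quotScalar (F := F) (Subgroup.zpowers (Units.mk0 ϖ hϖ0))
  -- §4 the datum, the leaf `hNE`, and ★ B6-core at `G'`
  have hc' : (IrrClass.mk r').IsSupercuspidal := by rw [IrrClass.isSupercuspidal_mk]; exact hsc''
  obtain ⟨r'', hr'', hsc₃, -, B, hBsymm, hBpos, hBinv⟩ := exists_rep_data_of_isSupercuspidal_quotScalar _ hZ (IrrClass.mk r') hc'
  haveI : r''.ρ.IsIrreducible := r''.isIrreducible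
  haveI : Nontrivial r''.V := Representation.IsIrreducible.nontrivial r''.ρ
  obtain ⟨v₁, hv₁⟩ := exists_ne (0 : r''.V)
  obtain ⟨Ω, Fl, M, hlim, hdom, hM⟩ := hNE μ' r'' hsc₃ B hBinv v₁
  have hG' := charLocIntNear_quotScalar_of_exists_nonell (Subgroup.zpowers (Units.mk0 ϖ hϖ0)) hϖ hΛ μ' hZ (IrrClass.mk r')
    ⟨r'', hr'', hsc₃, B, hBsymm, hBpos, hBinv, v₁, hv₁, Ω, Fl, M, hlim, hdom, hM⟩ (QuotientGroup.mk g)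
  rw [IrrClass.smoothTrace_mk] at hG'
  -- §5 the covering transport along `mk : GL₃(F) → G'` (★ B0b)
  have hker : ∃ O ∈ 𝓝 (1 : GL (Fin 3) F), ∀ x ∈ O,
      (QuotientGroup.mk' ((Subgroup.zpowers (Units.mk0 ϖ hϖ0)).map (Matrix.GeneralLinearGroup.scalar (Fin 3)))) x = 1 → x = 1 :=
    ⟨glInt 3 F, (isOpen_glInt 3 F).mem_nhds (Subgroup.one_mem _), fun x hx h1 => eq_one_of_mem_glInt_of_mk_eq_one hϖ hϖ0 hx h1⟩
  have hρ1 := K2E3CharLocIntNearCoveringTransport.charLocIntNear_comp_of_isOpenMap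
    (QuotientGroup.mk' ((Subgroup.zpowers (Units.mk0 ϖ hϖ0)).map (Matrix.GeneralLinearGroup.scalar (Fin 3))))
    QuotientGroup.continuous_mk QuotientGroup.isOpenMap_coe hker μ₀ μ' r'.ρ hadm'' g hG'
  -- §6 `r♭ ∘ mk ≃ r₁` (★ B0c's `e`): same character
  have heqv : (r₀.twist (χ.comp Matrix.GeneralLinearGroup.det) hχdet).ρ.smoothTrace μ₀ =
      Representation.smoothTrace (r'.ρ.comp (QuotientGroup.mk' ((Subgroup.zpowers (Units.mk0 ϖ hϖ0)).map (Matrix.GeneralLinearGroup.scalar (Fin 3))))) μ₀ :=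
    Representation.smoothTrace_eq_of_equiv
      (r'.ρ.comp (QuotientGroup.mk' ((Subgroup.zpowers (Units.mk0 ϖ hϖ0)).map (Matrix.GeneralLinearGroup.scalar (Fin 3)))) :
        Representation ℂ (GL (Fin 3) F) r'.V) μ₀
      (Representation.Equiv.mk e fun x => LinearMap.ext fun v => he x v)
  have h₁ : ∃ U : Set (GL (Fin 3) F), IsOpen U ∧ g ∈ U ∧ ∃ Θ : GL (Fin 3) F → ℂ, IntegrableOn Θ U μ₀ ∧
      ∀ f : GL (Fin 3) F → ℂ, f ∈ SchwartzBruhat (GL (Fin 3) F) → tsupport f ⊆ U →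
        (IrrClass.mk (r₀.twist (χ.comp Matrix.GeneralLinearGroup.det) hχdet)).smoothTrace μ₀ f = ∫ x, f x * Θ x ∂μ₀ := by
    obtain ⟨U, hU, hgU, Θ, hΘ, hch⟩ := hρ1
    refine ⟨U, hU, hgU, Θ, hΘ, fun f hf hfU => ?_⟩
    rw [IrrClass.smoothTrace_mk, heqv]
    exact hch f hf hfU
  -- §7 untwist (★ B0c (d))
  exact K2E3SmoothTraceTwist.charLocIntNear_of_twist μ₀ r₀ hadm (χ.comp Matrix.GeneralLinearGroup.det) hχdet g h₁

end Main

end Summit.HodgeConjecture.HodgeConjecture.Cruxes.H413.K2E3GL3SupercuspidalCharLocInt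

end
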